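import Summits.CriticalPhenomena.PercolationContinuityZ3.Theorems.PercNearOneGluingNoHeavyLowerTailIncStarCutVertex
import Literature.Probability.LatticeModels.ProdBernoulliClusterLocality
import HarnessLib

/-!
# Root-side reduction, I: the two-separator decomposition of principal cluster events

Support file for the Sahi programme (`--supports stmt-CriticalPhenomena-4575`, prover prim-sahi-p2 gen 12).
No definitions, no named facts, no sorries; standard axioms.  Memo `…/prim-sahi-p2/PROOF-E3.md` §23.

**Setting.**  A weight `w : Sym2 V → [0,1]` on a finite vertex type (product Bernoulli bond percolation on all
pairs), a *root side* `R` (a finite vertex set containing the root `s`) and two *separating vertices* `u, v ∉ R`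
such that `w s(x,z) = 0` whenever `x ∈ R` and `z ∉ R ∪ {u,v}`: every pair of positive weight meeting `R` lies
inside `R ∪ {u,v}`, i.e. `{u,v}` separates `R` from the rest of the graph.  The *root-side pairs* are the pairs
meeting `R` (note that `s(u,v)` is NOT one of them); for `x ∈ {u,v}` the *root-side connection* `{s ↔_R x}` is the
event that `s` is joined to `x` by open root-side pairs, `{ω | ω ∩ {e | ∃ y ∈ R, y ∈ e} ∈ openConn s x}`.

**Theorems.**
* `openConn_iff_exists_rootSide` (deterministic): on a configuration with no open pair from `R` to the outside of
  `R ∪ {u,v}`, for every target `t ∉ R`:  `s ↔ t  ⟺  ∃ x ∈ {u,v}, s ↔_R x ∧ x ↔ t inside Rᶜ`.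
* `real_principal_rootSide_eq`: for every nonempty target set `U` disjoint from `R`,
  `P(C_s ⊇ U) = P(s ↔_R u, s ↮_R v)·P(U ⊆ C_u^{Rᶜ}) + P(s ↮_R u, s ↔_R v)·P(U ⊆ C_v^{Rᶜ})
              + P(s ↔_R u, s ↔_R v)·P(U ⊆ C_u^{Rᶜ} ∪ C_v^{Rᶜ})`,
  where `C_x^{Rᶜ}` is the open cluster of `x` inside `Rᶜ` (root-side events are determined by the root-side pairs,
  the other three by the pairs inside `Rᶜ`: independence under the product measure).
Part II (`…SahiRootSideCongr`): two weights with the same no-exit property for `R`, equal off the root-side pairs and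
with the same three root-side cell probabilities have the same principal probabilities `P(C_s ⊇ U)`, `U ∩ R = ∅`, and the
same Sahi functionals `E_n` of principal families.  Part III (`…SahiRootSideClaw`) realises every root side by a claw
`s – h – {u,v}` with three explicit rational parameters, whence (cut vertex `h`) a minimal counterexample to Sahi
positivity of principal cluster events — in particular to the increasing-star inequality — has no two-separation whose
root side is free of targets, unless that side is the root alone (a root of degree two).
-/

noncomputable section

namespace Summit.CriticalPhenomena.PercolationContinuityZ3.Theorems

namespace SahiRootSide

open Finset MeasureTheory Literature.Combinatorics.Sahi2008 Literature.Probability.Percolation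
  Literature.Probability.LatticeModels
open Literature.Probability.Percolation.DecisionTree (ind ind_of_mem ind_of_not_mem ind_nonneg)
open Literature.Probability.Percolation.BlockExploration (exists_openWalk_of_mem_openConnIn
  mem_openConn_iff_openConnIn_univ)
open scoped Classical

variable {V : Type*}

/-! ### Deterministic structure at a two-separator -/

section Deterministic

variable {R : Set V} {s u v : V} (hs : s ∈ R) {ω : BondConfig V}
  (hω : ∀ x ∈ R, ∀ z, z ∉ R → z ≠ u → z ≠ v → s(x, z) ∉ ω)

/-- An open pair meeting `R` is an edge of the root-side open graph `openGraph (ω ∩ {root-side pairs})`.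
[this work] -/
theorem rootSide_adj {a b : V} (hab : s(a, b) ∈ ω) (hne : a ≠ b) (hmeet : a ∈ R ∨ b ∈ R) :
    (openGraph (ω ∩ {e : Sym2 V | ∃ y ∈ R, y ∈ e})).Adj a b := by
  rw [openGraph_adj]
  refine ⟨⟨hab, ?_⟩, hne⟩
  rcases hmeet with h | h
  · exact ⟨a, h, Sym2.mem_mk_left a b⟩
  · exact ⟨b, h, Sym2.mem_mk_right a b⟩

include hω in
/-- **Exit lemma.**  If `y` is joined to `z ≠ y` by open root-side pairs and `z ∉ R`, then `z ∈ {u, v}`: the last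
pair of the path meets `R` and ends outside `R`. [this work] -/
theorem eq_or_eq_of_rootSide_reachable {y z : V}
    (h : (openGraph (ω ∩ {e : Sym2 V | ∃ y ∈ R, y ∈ e})).Reachable y z) (hyz : y ≠ z) (hz : z ∉ R) :
    z = u ∨ z = v := by
  obtain ⟨p⟩ := h
  obtain ⟨z₁, hadj⟩ : ∃ z₁, (openGraph (ω ∩ {e : Sym2 V | ∃ y ∈ R, y ∈ e})).Adj z z₁ := by
    cases p.reverse with
    | nil => exact absurd rfl hyz
    | cons hadj _ => exact ⟨_, hadj⟩
  rw [openGraph_adj] at hadj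
  obtain ⟨⟨hmem, r, hr, hre⟩, hne⟩ := hadj
  have hr₁ : r = z₁ := by
    rcases Sym2.mem_iff.1 hre with h | h
    · exact absurd (h ▸ hr) hz
    · exact h
  subst hr₁
  by_contra hcon
  push Not at hcon
  have := hω r hr z hz hcon.1 hcon.2
  rw [Sym2.eq_swap] at this
  exact this hmem

include hs hω in
/-- **Two-separator decomposition of root connections (deterministic).**  On a configuration with no open pair
from `R` to the outside of `R ∪ {u,v}`, a target `t ∉ R` is joined to the root `s ∈ R` iff some `x ∈ {u,v}` is
joined to `s` by open ROOT-SIDE pairs and to `t` by an open path inside `Rᶜ`. [this work] -/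
theorem openConn_iff_exists_rootSide {t : V} (ht : t ∉ R) :
    ω ∈ openConn s t ↔ ∃ x, (x = u ∨ x = v) ∧
      ω ∩ {e : Sym2 V | ∃ y ∈ R, y ∈ e} ∈ (openConn s x : Set (BondConfig V)) ∧ ω ∈ openConnIn Rᶜ x t := by
  -- notation: `G₁` the root-side open graph
  set F : Set (Sym2 V) := {e : Sym2 V | ∃ y ∈ R, y ∈ e} with hF
  have hG₁le : openGraph (ω ∩ F) ≤ openGraph ω := openGraph_mono Set.inter_subset_left
  constructor
  swap
  · rintro ⟨x, -, h₁, h₂⟩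
    obtain ⟨p, -⟩ := exists_openWalk_of_mem_openConnIn h₂
    exact (SimpleGraph.Reachable.mono hG₁le h₁).trans ⟨p⟩
  intro hst
  -- the invariant propagated along an open walk from `s`
  let Inv : V → Prop := fun z => (openGraph (ω ∩ F)).Reachable s z ∨
    ∃ x, (x = u ∨ x = v) ∧ (openGraph (ω ∩ F)).Reachable s x ∧
      (ω ∈ openConnIn Rᶜ x z ∨ ∃ y, (y = u ∨ y = v) ∧ ω ∈ openConnIn Rᶜ x y ∧
        (openGraph (ω ∩ F)).Reachable y z)
  have hexit : ∀ {y z : V}, (openGraph (ω ∩ F)).Reachable y z → y ≠ z → z ∉ R → z = u ∨ z = v :=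
    fun h hyz hz => eq_or_eq_of_rootSide_reachable hω h hyz hz
  -- three marks `x, y, a ∈ {u,v}` with `y ≠ a`: then `x = y` or `x = a`
  have htwo : ∀ {x y a : V}, (x = u ∨ x = v) → (y = u ∨ y = v) → (a = u ∨ a = v) → y ≠ a → x = y ∨ x = a := by
    rintro x y a (rfl | rfl) (rfl | rfl) (rfl | rfl) hya
    all_goals first | exact Or.inl rfl | exact Or.inr rfl | exact absurd rfl hya
  have step : ∀ a b : V, Inv a → s(a, b) ∈ ω → a ≠ b → Inv b := by
    intro a b hInv hab hne
    by_cases hmeet : a ∈ R ∨ b ∈ R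
    · -- the pair is a root-side pair
      have hadj : (openGraph (ω ∩ F)).Reachable a b := (rootSide_adj hab hne hmeet).reachable
      rcases hInv with h | ⟨x, hx, hsx, h⟩
      · exact Or.inl (h.trans hadj)
      · rcases h with h | ⟨y, hy, hxy, hya⟩
        · -- `a ∈ Rᶜ` is reached inside `Rᶜ`; the pair meets `R`, so `b ∈ R` and `a ∈ {u,v}`
          have haR : a ∉ R := fun haR => h.2.1 haR
          have hbR : b ∈ R := by rcases hmeet with hm | hm; exacts [absurd hm haR, hm]
          have ha : a = u ∨ a = v := by
            by_contra hcon; push Not at hcon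
            have := hω b hbR a haR hcon.1 hcon.2
            rw [Sym2.eq_swap] at this
            exact this hab
          exact Or.inr ⟨x, hx, hsx, Or.inr ⟨a, ha, h, hadj⟩⟩
        · exact Or.inr ⟨x, hx, hsx, Or.inr ⟨y, hy, hxy, hya.trans hadj⟩⟩
    · -- the pair lies inside `Rᶜ`
      push Not at hmeet
      have hab₂ : ω ∈ openConnIn Rᶜ a b := openConnIn_of_adj hmeet.1 hmeet.2 hab hne
      rcases hInv with h | ⟨x, hx, hsx, h⟩
      · have hsa : s ≠ a := fun hsa => hmeet.1 (hsa ▸ hs)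
        have ha : a = u ∨ a = v := hexit h hsa hmeet.1
        exact Or.inr ⟨a, ha, h, Or.inl hab₂⟩
      · rcases h with h | ⟨y, hy, hxy, hya⟩
        · exact Or.inr ⟨x, hx, hsx, Or.inl (PlanarDuality.openConnIn_trans h hab₂)⟩
        · by_cases hya' : y = a
          · subst hya'
            exact Or.inr ⟨x, hx, hsx, Or.inl (PlanarDuality.openConnIn_trans hxy hab₂)⟩
          · have ha : a = u ∨ a = v := hexit hya hya' hmeet.1
            have hsa : (openGraph (ω ∩ F)).Reachable s a := by
              rcases htwo hx hy ha hya' with rfl | rfl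
              · exact hsx.trans hya
              · exact hsx
            exact Or.inr ⟨a, ha, hsa, Or.inl hab₂⟩
  -- propagate the invariant along an open walk from `s` to `t`
  have hwalk : ∀ {a b : V} (p : (openGraph ω).Walk a b), b = s → Inv a := by
    intro a b p
    induction p with
    | nil => intro h; subst h; exact Or.inl (SimpleGraph.Reachable.refl _)
    | @cons a' c' b' hadj q ih =>
      intro hb
      have hc := ih hb
      rw [openGraph_adj] at hadj
      have hadj' : s(c', a') ∈ ω := by rw [Sym2.eq_swap]; exact hadj.1
      exact step c' a' hc hadj' hadj.2.symm
  obtain ⟨p⟩ := hst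
  have hInvt : Inv t := hwalk p.reverse rfl
  -- read off the conclusion at `t ∉ R`
  have htc : t ∈ Rᶜ := ht
  rcases hInvt with h | ⟨x, hx, hsx, h⟩
  · have hst' : s ≠ t := fun h' => ht (h' ▸ hs)
    exact ⟨t, hexit h hst' ht, h, openConnIn_refl htc⟩
  · rcases h with h | ⟨y, hy, hxy, hyt⟩
    · exact ⟨x, hx, hsx, h⟩
    · by_cases hyt' : y = t
      · subst hyt'; exact ⟨x, hx, hsx, hxy⟩
      · have ht' : t = u ∨ t = v := hexit hyt hyt' ht
        rcases htwo hx hy ht' hyt' with rfl | rfl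
        · exact ⟨t, ht', hsx.trans hyt, openConnIn_refl htc⟩
        · exact ⟨x, hx, hsx, openConnIn_refl htc⟩

end Deterministic

/-! ### The decomposition of principal cluster events -/

section Measure

variable [Fintype V]

omit [Fintype V] in
/-- Indicators of events with the same membership agree (plumbing). [folklore] -/
private theorem ind_congr_mem {α : Type*} {A B : Set α} {a : α} (h : a ∈ A ↔ a ∈ B) : ind A a = ind B a := by
  by_cases ha : a ∈ A
  · rw [ind_of_mem ha, ind_of_mem (h.1 ha)]
  · rw [ind_of_not_mem ha, ind_of_not_mem (fun hb => ha (h.2 hb))]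

omit [Fintype V] in
/-- The outside events `{x ↔ t inside Rᶜ}` are determined by the pairs NOT meeting `R`. [this work] -/
theorem determinedBy_openConnIn_compl (R : Set V) (x t : V) :
    DeterminedBy (openConnIn Rᶜ x t : Set (BondConfig V)) {e : Sym2 V | ∃ y ∈ R, y ∈ e}ᶜ := by
  refine (IncStarCutVertex.determinedBy_openConnIn_offDiag Rᶜ x t).mono fun z hz => ?_
  rintro ⟨y, hyR, hyz⟩
  exact hz.2 y hyz hyR

omit [Fintype V] in
/-- The root-side connection events `{s ↔_R x}` are determined by the pairs meeting `R` (plumbing). [this work] -/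
theorem determinedBy_rootSide (R : Set V) (s x : V) :
    DeterminedBy {ω : BondConfig V | ω ∩ {e : Sym2 V | ∃ y ∈ R, y ∈ e} ∈ (openConn s x : Set (BondConfig V))}
      {e : Sym2 V | ∃ y ∈ R, y ∈ e} :=
  (determinedBy_iff _ _).2 fun ω ω' h => by simp only [Set.mem_setOf_eq, h]

/-- **The two-separator decomposition of principal cluster events.**  Let `{u, v}` separate the root side `R ∋ s`
from the rest (no pair of positive weight from `R` to the outside of `R ∪ {u,v}`).  For every nonempty target set
`U` disjoint from `R`,
`P(C_s ⊇ U) = P(s ↔_R u, s ↮_R v)·P(U ⊆ C_u^{Rᶜ}) + P(s ↮_R u, s ↔_R v)·P(U ⊆ C_v^{Rᶜ})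
            + P(s ↔_R u, s ↔_R v)·P(U ⊆ C_u^{Rᶜ} ∪ C_v^{Rᶜ})`,
where `{s ↔_R x}` is connection by open pairs meeting `R` and `C_x^{Rᶜ}` is the open cluster of `x` inside `Rᶜ`.
[this work] -/
theorem real_principal_rootSide_eq (w : Sym2 V → unitInterval) (R : Finset V) {s u v : V} (hs : s ∈ R)
    (hw : ∀ x ∈ R, ∀ z, z ∉ R → z ≠ u → z ≠ v → w s(x, z) = 0)
    (U : Finset V) (hU0 : U.Nonempty) (hU : ∀ t ∈ U, t ∉ R) :
    (prodBernoulli w).real (⋂ t ∈ U, (openConn s t : Set (BondConfig V))) =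
      (prodBernoulli w).real {ω | ω ∩ {e : Sym2 V | ∃ y ∈ (R : Set V), y ∈ e} ∈ (openConn s u : Set (BondConfig V)) ∧
          ω ∩ {e : Sym2 V | ∃ y ∈ (R : Set V), y ∈ e} ∉ (openConn s v : Set (BondConfig V))} *
        (prodBernoulli w).real (⋂ t ∈ U, (openConnIn (↑R)ᶜ u t : Set (BondConfig V))) +
      (prodBernoulli w).real {ω | ω ∩ {e : Sym2 V | ∃ y ∈ (R : Set V), y ∈ e} ∉ (openConn s u : Set (BondConfig V)) ∧
          ω ∩ {e : Sym2 V | ∃ y ∈ (R : Set V), y ∈ e} ∈ (openConn s v : Set (BondConfig V))} *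
        (prodBernoulli w).real (⋂ t ∈ U, (openConnIn (↑R)ᶜ v t : Set (BondConfig V))) +
      (prodBernoulli w).real {ω | ω ∩ {e : Sym2 V | ∃ y ∈ (R : Set V), y ∈ e} ∈ (openConn s u : Set (BondConfig V)) ∧
          ω ∩ {e : Sym2 V | ∃ y ∈ (R : Set V), y ∈ e} ∈ (openConn s v : Set (BondConfig V))} *
        (prodBernoulli w).real (⋂ t ∈ U, (openConnIn (↑R)ᶜ u t ∪ openConnIn (↑R)ᶜ v t : Set (BondConfig V))) := by
  set F : Set (Sym2 V) := {e : Sym2 V | ∃ y ∈ (R : Set V), y ∈ e} with hF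
  set Au : Set (BondConfig V) := {ω | ω ∩ F ∈ (openConn s u : Set (BondConfig V))} with hAu
  set Av : Set (BondConfig V) := {ω | ω ∩ F ∈ (openConn s v : Set (BondConfig V))} with hAv
  set Ou : Set (BondConfig V) := ⋂ t ∈ U, (openConnIn (↑R)ᶜ u t : Set (BondConfig V)) with hOu
  set Ov : Set (BondConfig V) := ⋂ t ∈ U, (openConnIn (↑R)ᶜ v t : Set (BondConfig V)) with hOv
  set Ouv : Set (BondConfig V) := ⋂ t ∈ U, (openConnIn (↑R)ᶜ u t ∪ openConnIn (↑R)ᶜ v t : Set (BondConfig V))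
    with hOuv
  set PU : Set (BondConfig V) := ⋂ t ∈ U, (openConn s t : Set (BondConfig V)) with hPU
  -- the three cells as sets
  have hE₁ : {ω : BondConfig V | ω ∩ F ∈ (openConn s u : Set (BondConfig V)) ∧
      ω ∩ F ∉ (openConn s v : Set (BondConfig V))} = Au ∩ Avᶜ := by ext ω; simp [hAu, hAv]
  have hE₂ : {ω : BondConfig V | ω ∩ F ∉ (openConn s u : Set (BondConfig V)) ∧
      ω ∩ F ∈ (openConn s v : Set (BondConfig V))} = Auᶜ ∩ Av := by ext ω; simp [hAu, hAv]
  have hE₃ : {ω : BondConfig V | ω ∩ F ∈ (openConn s u : Set (BondConfig V)) ∧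
      ω ∩ F ∈ (openConn s v : Set (BondConfig V))} = Au ∩ Av := by ext ω; simp [hAu, hAv]
  rw [hE₁, hE₂, hE₃]
  -- (1) pointwise identity on configurations of positive weight
  have hpt : ∀ ω : BondConfig V, bernoulliWeight w ω ≠ 0 →
      ind PU ω = ind (Au ∩ Avᶜ ∩ Ou) ω + ind (Auᶜ ∩ Av ∩ Ov) ω + ind (Au ∩ Av ∩ Ouv) ω := by
    intro ω hωw
    have hω : ∀ x ∈ (R : Set V), ∀ z, z ∉ (R : Set V) → z ≠ u → z ≠ v → s(x, z) ∉ ω :=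
      fun x hx z hz hzu hzv hmem => hωw (IncStarCycle.bernoulliWeight_eq_zero_of_mem w hmem
        (hw x (Finset.mem_coe.1 hx) z (fun h => hz (Finset.mem_coe.2 h)) hzu hzv))
    have key : ω ∈ PU ↔ ∀ t ∈ U, ∃ x, (x = u ∨ x = v) ∧ ω ∩ F ∈ (openConn s x : Set (BondConfig V)) ∧
        ω ∈ openConnIn (↑R)ᶜ x t := by
      simp only [hPU, Set.mem_iInter]
      refine forall₂_congr fun t ht => ?_
      exact openConn_iff_exists_rootSide (Finset.mem_coe.2 hs) hω (fun h => hU t ht (Finset.mem_coe.1 h))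
    by_cases cu : ω ∈ Au <;> by_cases cv : ω ∈ Av
    · -- both root-side connections: `PU ↔ Ouv`
      have h1 : ω ∉ Au ∩ Avᶜ ∩ Ou := fun h => h.1.2 cv
      have h2 : ω ∉ Auᶜ ∩ Av ∩ Ov := fun h => h.1.1 cu
      have h3 : ω ∈ PU ↔ ω ∈ Au ∩ Av ∩ Ouv := by
        rw [key]
        simp only [Set.mem_inter_iff, cu, cv, true_and, hOuv, Set.mem_iInter, Set.mem_union]
        refine forall₂_congr fun t _ => ⟨?_, ?_⟩
        · rintro ⟨x, hx, -, hxt⟩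
          rcases hx with rfl | rfl
          · exact Or.inl hxt
          · exact Or.inr hxt
        · rintro (h | h)
          · exact ⟨u, Or.inl rfl, cu, h⟩
          · exact ⟨v, Or.inr rfl, cv, h⟩
      rw [ind_congr_mem h3, ind_of_not_mem h1, ind_of_not_mem h2]; ring
    · -- only `u`
      have h2 : ω ∉ Auᶜ ∩ Av ∩ Ov := fun h => h.1.1 cu
      have h3 : ω ∉ Au ∩ Av ∩ Ouv := fun h => cv h.1.2
      have h1 : ω ∈ PU ↔ ω ∈ Au ∩ Avᶜ ∩ Ou := by
        rw [key]
        simp only [Set.mem_inter_iff, Set.mem_compl_iff, cu, cv, not_false_eq_true, true_and, hOu,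
          Set.mem_iInter]
        refine forall₂_congr fun t _ => ⟨?_, fun h => ⟨u, Or.inl rfl, cu, h⟩⟩
        rintro ⟨x, hx, hsx, hxt⟩
        rcases hx with rfl | rfl
        · exact hxt
        · exact absurd hsx cv
      rw [ind_congr_mem h1, ind_of_not_mem h2, ind_of_not_mem h3]; ring
    · -- only `v`
      have h1 : ω ∉ Au ∩ Avᶜ ∩ Ou := fun h => cu h.1.1
      have h3 : ω ∉ Au ∩ Av ∩ Ouv := fun h => cu h.1.1
      have h2 : ω ∈ PU ↔ ω ∈ Auᶜ ∩ Av ∩ Ov := by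
        rw [key]
        simp only [Set.mem_inter_iff, Set.mem_compl_iff, cu, cv, not_false_eq_true, true_and, hOv,
          Set.mem_iInter]
        refine forall₂_congr fun t _ => ⟨?_, fun h => ⟨v, Or.inr rfl, cv, h⟩⟩
        rintro ⟨x, hx, hsx, hxt⟩
        rcases hx with rfl | rfl
        · exact absurd hsx cu
        · exact hxt
      rw [ind_congr_mem h2, ind_of_not_mem h1, ind_of_not_mem h3]; ring
    · -- neither: `PU` fails since `U` is nonempty
      have h1 : ω ∉ Au ∩ Avᶜ ∩ Ou := fun h => cu h.1.1
      have h2 : ω ∉ Auᶜ ∩ Av ∩ Ov := fun h => cv h.1.2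
      have h3 : ω ∉ Au ∩ Av ∩ Ouv := fun h => cu h.1.1
      have h0 : ω ∉ PU := by
        rw [key]
        intro h
        obtain ⟨t, ht⟩ := hU0
        obtain ⟨x, hx, hsx, -⟩ := h t ht
        rcases hx with rfl | rfl
        · exact cu hsx
        · exact cv hsx
      rw [ind_of_not_mem h0, ind_of_not_mem h1, ind_of_not_mem h2, ind_of_not_mem h3]; ring
  -- (2) sum over configurations
  have hsum : (prodBernoulli w).real PU = (prodBernoulli w).real (Au ∩ Avᶜ ∩ Ou) +
      (prodBernoulli w).real (Auᶜ ∩ Av ∩ Ov) + (prodBernoulli w).real (Au ∩ Av ∩ Ouv) := by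
    simp only [prodBernoulli_real_eq_sum_weight_ind, ← Finset.sum_add_distrib, ← mul_add]
    refine Finset.sum_congr rfl fun ω _ => ?_
    by_cases hωw : bernoulliWeight w ω = 0
    · have : BHK2006.weight (fun e => (w e : ℝ)) ω = 0 := hωw
      rw [this, zero_mul, zero_mul]
    · rw [hpt ω hωw, add_assoc]
  rw [hsum]
  -- (3) independence: root-side cells vs. outside events
  set FF : Finset (Sym2 V) := Finset.univ.filter (fun e : Sym2 V => ∃ y ∈ (R : Set V), y ∈ e) with hFFdef
  have hFF : (↑FF : Set (Sym2 V)) = F := by ext e; simp [hFFdef, hF]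
  have hFFc : (↑FFᶜ : Set (Sym2 V)) = Fᶜ := by rw [Finset.coe_compl, hFF]
  have hm : ∀ X : Set (BondConfig V), MeasurableSet X := fun _ => MeasurableSet.of_discrete
  have hdA : ∀ x : V, DeterminedBy {ω : BondConfig V | ω ∩ F ∈ (openConn s x : Set (BondConfig V))} ↑FF :=
    fun x => by rw [hFF]; exact determinedBy_rootSide (↑R) s x
  have hdAu : DeterminedBy Au ↑FF := hdA u
  have hdAv : DeterminedBy Av ↑FF := hdA v
  have hdO : ∀ x t : V, DeterminedBy (openConnIn (↑R)ᶜ x t : Set (BondConfig V)) ↑FFᶜ :=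
    fun x t => by rw [hFFc]; exact determinedBy_openConnIn_compl (↑R) x t
  have hdet_cell : ∀ {A B : Set (BondConfig V)}, DeterminedBy A ↑FF → DeterminedBy B ↑FF →
      DeterminedBy (A ∩ Bᶜ) ↑FF ∧ DeterminedBy (Aᶜ ∩ B) ↑FF ∧ DeterminedBy (A ∩ B) ↑FF := by
    intro A B hA hB
    rw [determinedBy_iff] at hA hB
    refine ⟨(determinedBy_iff _ _).2 fun ω ω' h => ?_, (determinedBy_iff _ _).2 fun ω ω' h => ?_,
      (determinedBy_iff _ _).2 fun ω ω' h => ?_⟩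
    · simp only [Set.mem_inter_iff, Set.mem_compl_iff, hA ω ω' h, hB ω ω' h]
    · simp only [Set.mem_inter_iff, Set.mem_compl_iff, hA ω ω' h, hB ω ω' h]
    · simp only [Set.mem_inter_iff, hA ω ω' h, hB ω ω' h]
  obtain ⟨hd₁, hd₂, hd₃⟩ := hdet_cell hdAu hdAv
  have hdOu : DeterminedBy Ou ↑FFᶜ := (determinedBy_iff _ _).2 fun ω ω' h => by
    simp only [hOu, Set.mem_iInter]
    exact forall₂_congr fun t _ => (determinedBy_iff _ _).1 (hdO u t) ω ω' h
  have hdOv : DeterminedBy Ov ↑FFᶜ := (determinedBy_iff _ _).2 fun ω ω' h => by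
    simp only [hOv, Set.mem_iInter]
    exact forall₂_congr fun t _ => (determinedBy_iff _ _).1 (hdO v t) ω ω' h
  have hdOuv : DeterminedBy Ouv ↑FFᶜ := (determinedBy_iff _ _).2 fun ω ω' h => by
    simp only [hOuv, Set.mem_iInter, Set.mem_union]
    exact forall₂_congr fun t _ => or_congr ((determinedBy_iff _ _).1 (hdO u t) ω ω' h)
      ((determinedBy_iff _ _).1 (hdO v t) ω ω' h)
  rw [prodBernoulli_real_inter_of_determinedBy_disjoint w disjoint_compl_right hd₁ hdOu (hm _) (hm _),
    prodBernoulli_real_inter_of_determinedBy_disjoint w disjoint_compl_right hd₂ hdOv (hm _) (hm _),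
    prodBernoulli_real_inter_of_determinedBy_disjoint w disjoint_compl_right hd₃ hdOuv (hm _) (hm _)]

end Measure

end SahiRootSide

end Summit.CriticalPhenomena.PercolationContinuityZ3.Theorems
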